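import Literature.Topology.Euclidean.LatticeCubeSkeleton
import Mathlib.Analysis.Convex.Basic
import HarnessLib

/-!
# Lattice boxes in `ℝᴺ`: convex unions of lattice cubes around a ball

Topic `Literature/Topology/Euclidean`, continuing `LatticeCubeComplex.lean` /
`LatticeCubeSkeleton.lean`. A **lattice box** is a product of lattice intervals
`∏ᵢ [loᵢ h, hiᵢ h]`, `lo, hi ∈ ℤᴺ`. Boxes are convex and are unions of lattice cubes; a face of
the lattice whose relative interior meets a box lies in the box; the box `boxAround` a sup-norm
ball `closedBall c ρ` contains the ball and is contained in `closedBall c (ρ + h)`. These are the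
convex sub-complexes in which cone extensions are performed during cellular approximation on
cube complexes (Hatcher, *Algebraic Topology* (2002), proof of Thm. 4.8 / Appendix Thm. A.7 use
such local convexity of cube complexes implicitly).

* `LatticeCube.box lo hi h`, `LatticeCube.convex_box`, `LatticeCube.exists_top_of_mem_box`,
  `LatticeCube.carrier_subset_box_of_mem_relint`, `LatticeCube.box_subset_complex`;
* `LatticeCube.boxLo`, `LatticeCube.boxHi`, `LatticeCube.closedBall_subset_box`,
  `LatticeCube.box_subset_closedBall`.

No `sorry`; [folklore] throughout.

## References

* A. Hatcher, *Algebraic Topology*, CUP (2002), §4.1 proof of Thm. 4.8; Appendix, proof of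
  Thm. A.7. [HatcherAT2002]
-/

noncomputable section

open Set Metric Topology Function

namespace Literature.Topology.Euclidean

namespace LatticeCube

variable {N : ℕ} {h : ℝ}

/-! ### Lattice boxes -/

/-- The **lattice box** `∏ᵢ [loᵢ h, hiᵢ h]`. [folklore] -/
def box (lo hi : Fin N → ℤ) (h : ℝ) : Set (Fin N → ℝ) :=
  {x | ∀ i, (lo i : ℝ) * h ≤ x i ∧ x i ≤ (hi i : ℝ) * h}

variable {lo hi : Fin N → ℤ}

/-- Membership in a box. [folklore] -/
theorem mem_box {x : Fin N → ℝ} : x ∈ box lo hi h ↔ ∀ i, (lo i : ℝ) * h ≤ x i ∧ x i ≤ (hi i : ℝ) * h :=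
  Iff.rfl

/-- A box is a product of intervals. [folklore] -/
theorem box_eq_pi (lo hi : Fin N → ℤ) (h : ℝ) :
    box lo hi h = Set.pi univ fun i => Icc ((lo i : ℝ) * h) ((hi i : ℝ) * h) := by
  ext x
  simp only [Set.mem_univ_pi, mem_Icc]
  rfl

/-- Boxes are convex. [folklore] -/
theorem convex_box (lo hi : Fin N → ℤ) (h : ℝ) : Convex ℝ (box lo hi h) := by
  rw [box_eq_pi]
  exact convex_pi fun i _ => convex_Icc _ _

/-- Boxes are closed. [folklore] -/
theorem isClosed_box (lo hi : Fin N → ℤ) (h : ℝ) : IsClosed (box lo hi h) := by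
  rw [box_eq_pi]
  exact isClosed_set_pi fun i _ => isClosed_Icc

/-- A lattice cube with `lo ≤ b`, `b + 1 ≤ hi` lies in the box. [folklore] -/
theorem carrier_top_subset_box (hh : 0 ≤ h) {b : Fin N → ℤ} (hlo : ∀ i, lo i ≤ b i)
    (hhi : ∀ i, b i + 1 ≤ hi i) : (Face.top N b).carrier h ⊆ box lo hi h := by
  intro x hx
  rw [Face.mem_carrier_top] at hx
  intro i
  have h1 : (lo i : ℝ) ≤ b i := by exact_mod_cast hlo i
  have h2 : (b i : ℝ) + 1 ≤ hi i := by exact_mod_cast hhi i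
  constructor <;> nlinarith [hx i]

/-- **Every point of a nondegenerate box lies in a lattice cube contained in the box.**
[folklore] -/
theorem exists_top_of_mem_box (hh : 0 < h) (hlt : ∀ i, lo i < hi i) {x : Fin N → ℝ}
    (hx : x ∈ box lo hi h) :
    ∃ b : Fin N → ℤ, (∀ i, lo i ≤ b i) ∧ (∀ i, b i + 1 ≤ hi i) ∧ x ∈ (Face.top N b).carrier h := by
  refine ⟨fun i => min ⌊x i / h⌋ (hi i - 1), fun i => ?_, fun i => ?_, ?_⟩
  · refine le_min ?_ (by linarith [hlt i])
    have h1 : (lo i : ℝ) ≤ x i / h := by rw [le_div_iff₀ hh]; exact (hx i).1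
    exact Int.le_floor.2 h1
  · linarith [min_le_right ⌊x i / h⌋ (hi i - 1)]
  · rw [Face.mem_carrier_top]
    intro i
    constructor
    · -- `bᵢ ≤ ⌊xᵢ / h⌋`, so `bᵢ h ≤ xᵢ`
      have h1 : ((min ⌊x i / h⌋ (hi i - 1) : ℤ) : ℝ) ≤ ⌊x i / h⌋ := by
        exact_mod_cast min_le_left _ _
      have h2 : ((⌊x i / h⌋ : ℤ) : ℝ) ≤ x i / h := Int.floor_le _
      have h3 : ((⌊x i / h⌋ : ℤ) : ℝ) * h ≤ x i := by rwa [le_div_iff₀ hh] at h2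
      nlinarith
    · rcases le_total ⌊x i / h⌋ (hi i - 1) with hc | hc
      · rw [min_eq_left hc]
        have h2 : x i / h < (⌊x i / h⌋ : ℝ) + 1 := Int.lt_floor_add_one _
        rw [div_lt_iff₀ hh] at h2
        exact h2.le
      · rw [min_eq_right hc]
        push_cast
        linarith [(hx i).2]

/-- **A lattice face whose relative interior meets a box lies in the box.** [folklore] -/
theorem carrier_subset_box_of_mem_relint (hh : 0 < h) (hlt : ∀ i, lo i < hi i) {G : Face N}
    {y : Fin N → ℝ} (hy : y ∈ box lo hi h) (hyG : y ∈ G.relint h) : G.carrier h ⊆ box lo hi h := by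
  obtain ⟨b, hlo, hhi, hyb⟩ := exists_top_of_mem_box hh hlt hy
  exact (G.carrier_subset_carrier_top hh.le (Face.isFaceOf_of_mem_relint_of_mem_top hh hyG hyb)).trans
    (carrier_top_subset_box hh.le hlo hhi)

/-- A box all of whose lattice cubes belong to `𝒬` lies in the complex. [folklore] -/
theorem box_subset_complex (hh : 0 < h) (hlt : ∀ i, lo i < hi i) {𝒬 : Finset (Fin N → ℤ)}
    (h𝒬 : ∀ b : Fin N → ℤ, (∀ i, lo i ≤ b i) → (∀ i, b i + 1 ≤ hi i) → b ∈ 𝒬) :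
    box lo hi h ⊆ complex 𝒬 h := by
  intro x hx
  obtain ⟨b, hlo, hhi, hxb⟩ := exists_top_of_mem_box hh hlt hx
  exact mem_complex.2 ⟨b, h𝒬 b hlo hhi, hxb⟩

/-! ### The box around a ball -/

/-- Lower corner of the lattice box around `closedBall c ρ`. [folklore] -/
def boxLo (c : Fin N → ℝ) (ρ h : ℝ) : Fin N → ℤ := fun i => ⌊(c i - ρ) / h⌋

/-- Upper corner of the lattice box around `closedBall c ρ`. [folklore] -/
def boxHi (c : Fin N → ℝ) (ρ h : ℝ) : Fin N → ℤ := fun i => ⌊(c i + ρ) / h⌋ + 1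

/-- The box around a ball is nondegenerate. [folklore] -/
theorem boxLo_lt_boxHi (hh : 0 < h) {c : Fin N → ℝ} {ρ : ℝ} (hρ : 0 ≤ ρ) (i : Fin N) :
    boxLo c ρ h i < boxHi c ρ h i := by
  unfold boxLo boxHi
  have : ⌊(c i - ρ) / h⌋ ≤ ⌊(c i + ρ) / h⌋ :=
    Int.floor_le_floor (div_le_div_of_nonneg_right (by linarith) hh.le)
  omega

/-- **The ball lies in the box around it.** [folklore] -/
theorem closedBall_subset_box (hh : 0 < h) (c : Fin N → ℝ) (ρ : ℝ) :
    closedBall c ρ ⊆ box (boxLo c ρ h) (boxHi c ρ h) h := by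
  intro x hx i
  have hxi : |x i - c i| ≤ ρ := by
    rw [← Real.dist_eq]
    exact (dist_le_pi_dist x c i).trans (mem_closedBall.1 hx)
  rw [abs_le] at hxi
  unfold boxLo boxHi
  constructor
  · have h1 : ((⌊(c i - ρ) / h⌋ : ℤ) : ℝ) ≤ (c i - ρ) / h := Int.floor_le _
    rw [le_div_iff₀ hh] at h1
    linarith
  · have h1 : (c i + ρ) / h < (⌊(c i + ρ) / h⌋ : ℝ) + 1 := Int.lt_floor_add_one _
    rw [div_lt_iff₀ hh] at h1
    push_cast
    linarith

/-- **The box around a ball lies in the `h`-bigger ball.** [folklore] -/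
theorem box_subset_closedBall (hh : 0 < h) (c : Fin N → ℝ) {ρ : ℝ} (hρ : 0 ≤ ρ) :
    box (boxLo c ρ h) (boxHi c ρ h) h ⊆ closedBall c (ρ + h) := by
  intro x hx
  rw [mem_closedBall, dist_pi_le_iff (by linarith)]
  intro i
  obtain ⟨h1, h2⟩ := hx i
  unfold boxLo at h1
  unfold boxHi at h2
  push_cast at h2
  rw [Real.dist_eq, abs_le]
  have h3 : (c i - ρ) / h < (⌊(c i - ρ) / h⌋ : ℝ) + 1 := Int.lt_floor_add_one _
  rw [div_lt_iff₀ hh] at h3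
  have h4 : ((⌊(c i + ρ) / h⌋ : ℤ) : ℝ) ≤ (c i + ρ) / h := Int.floor_le _
  rw [le_div_iff₀ hh] at h4
  constructor <;> nlinarith

/-- A lattice cube of the box around `closedBall c ρ` meets `closedBall c (ρ + h)`. [folklore] -/
theorem carrier_top_inter_closedBall_nonempty (hh : 0 < h) (c : Fin N → ℝ) {ρ : ℝ} (hρ : 0 ≤ ρ)
    {b : Fin N → ℤ} (hlo : ∀ i, boxLo c ρ h i ≤ b i) (hhi : ∀ i, b i + 1 ≤ boxHi c ρ h i) :
    ((Face.top N b).carrier h ∩ closedBall c (ρ + h)).Nonempty := by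
  refine ⟨fun i => (b i : ℝ) * h, ?_, ?_⟩
  · rw [Face.mem_carrier_top]
    intro i
    constructor <;> nlinarith
  · exact box_subset_closedBall hh c hρ (carrier_top_subset_box hh.le hlo hhi (by
      rw [Face.mem_carrier_top]; intro i; constructor <;> nlinarith))

/-- **The box around a ball lies in the complex** as soon as every lattice cube meeting
`closedBall c (ρ + h)` belongs to `𝒬`. [folklore] -/
theorem boxAround_subset_complex (hh : 0 < h) (c : Fin N → ℝ) {ρ : ℝ} (hρ : 0 ≤ ρ)
    {𝒬 : Finset (Fin N → ℤ)}
    (h𝒬 : ∀ b : Fin N → ℤ, ((Face.top N b).carrier h ∩ closedBall c (ρ + h)).Nonempty → b ∈ 𝒬) :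
    box (boxLo c ρ h) (boxHi c ρ h) h ⊆ complex 𝒬 h :=
  box_subset_complex hh (boxLo_lt_boxHi hh hρ) fun b hlo hhi =>
    h𝒬 b (carrier_top_inter_closedBall_nonempty hh c hρ hlo hhi)

end LatticeCube

end Literature.Topology.Euclidean

end
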